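import Summits.MatrixMultiplication.OmegaCensus.STPPCell22Sound5

/-!
# ω-census (abelian STPP census): cell-(2,2) certificate soundness, part 6 — last small bridges (tool file)

HONEST FRAMING (pub-omega census; verbatim): lottery ticket; floor = certified bounds/negative ranges.
Census STRUCTURE (seat pub-omega-stpp-1 gen 33, 2026-08-29), family (b2).  `offMask_lt`; complement of a disjoint union of masks
(`compl_xor_eq_compl_or`); the 9-point pattern mask `xMask 61 y₀ w y₀'` represents `{0,1,y₀} + w•{0,1,y₀'}` (`rep_xMask61`); a translate missing `60`
(`sixty_not_mem_image`).  UNCONDITIONAL; no `decide`.  Nothing here is progress on `ω`.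

References: H. S. Warren, Hacker's Delight (2002), §2-1 (bit sets); H. Cohn, R. Kleinberg, B. Szegedy, C. Umans, FOCS 2005, Def. 5.1 (the use).
-/

open Finset
open scoped Pointwise

namespace Summit.MatrixMultiplication.OmegaCensus.CubeNB.S2

open Summit.MatrixMultiplication.OmegaCensus.CubeNB.Bits

/-- `offMask` is below `p` (for `0 < p`). [folklore] -/
theorem offMask_lt {p σ S : ℕ} (hp : 0 < p) : offMask p σ S < p := by
  unfold offMask
  cases hf : (List.range p).find? (fun t => Nat.beq (rot p σ t) S) with
  | none => simpa using hp
  | some a => have := List.mem_of_find?_eq_some hf; simpa [List.mem_range] using this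

/-- Complement of a disjoint union: `(full ⊕ a) ⊕ b = full ⊕ (a ∪ b)` for disjoint masks below `2^p`. [folklore] -/
theorem compl_xor_eq_compl_or {p a b : ℕ} (ha : a < 2 ^ p) (hb : b < 2 ^ p) (hdisj : ∀ v, ¬(tb a v = true ∧ tb b v = true)) :
    (fullMask p ^^^ a) ^^^ b = fullMask p ^^^ (a ||| b) := by
  have hf : fullMask p < 2 ^ p := by rw [fullMask_eq]; exact Nat.sub_lt (Nat.one_le_two_pow) Nat.one_pos
  refine eq_of_tb_eq (Nat.xor_lt_two_pow (Nat.xor_lt_two_pow hf ha) hb) (Nat.xor_lt_two_pow hf (Nat.or_lt_two_pow ha hb)) fun v hv => ?_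
  rw [tb_xor, tb_compl hv, tb_compl hv, tb_lor]
  have h := hdisj v
  cases h1 : tb a v <;> cases h2 : tb b v <;> simp_all

/-- **The pattern mask represents `{0,1,y₀} + w•{0,1,y₀'}`** (at `p = 61`). [folklore] -/
theorem rep_xMask61 {y₀ y₀' : ℕ} (hy₀ : y₀ < 61) (hy₀' : y₀' < 61) (w : ZMod 61) :
    ∀ v, tb (xMask 61 y₀ w.val y₀') v = true ↔
      ∃ x ∈ (({0, 1, ((y₀ : ℕ) : ZMod 61)} : Finset (ZMod 61)) + ({0, 1, ((y₀' : ℕ) : ZMod 61)} : Finset (ZMod 61)).image (w * ·)), x.val = v := by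
  haveI : Fact (1 < 61) := ⟨by norm_num⟩
  have hyAval : (((y₀ : ℕ) : ZMod 61)).val = y₀ := by rw [ZMod.val_natCast, Nat.mod_eq_of_lt hy₀]
  have hyBval : (((y₀' : ℕ) : ZMod 61)).val = y₀' := by rw [ZMod.val_natCast, Nat.mod_eq_of_lt hy₀']
  intro v
  rw [tb_xMask]
  constructor
  · rintro ⟨a, ha, b, hb', rfl⟩
    refine ⟨((a : ℕ) : ZMod 61) + w * ((b : ℕ) : ZMod 61), add_mem_add ?_ (mem_image.2 ⟨((b : ℕ) : ZMod 61), ?_, rfl⟩), ?_⟩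
    · simp only [List.mem_cons, List.not_mem_nil, or_false] at ha
      rcases ha with rfl | rfl | rfl <;> simp
    · simp only [List.mem_cons, List.not_mem_nil, or_false] at hb'
      rcases hb' with rfl | rfl | rfl <;> simp
    · have ha61 : a < 61 := by simp only [List.mem_cons, List.not_mem_nil, or_false] at ha; omega
      have hb61 : b < 61 := by simp only [List.mem_cons, List.not_mem_nil, or_false] at hb'; omega
      rw [ZMod.val_add, ZMod.val_mul, ZMod.val_natCast, ZMod.val_natCast, Nat.mod_eq_of_lt ha61, Nat.mod_eq_of_lt hb61]
      generalize w.val * b = m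
      omega
  · rintro ⟨x, hx, rfl⟩
    obtain ⟨a', ha', b'', hb'', rfl⟩ := mem_add.1 hx
    obtain ⟨b', hb', rfl⟩ := mem_image.1 hb''
    simp only [mem_insert, mem_singleton] at ha' hb'
    refine ⟨a'.val, ?_, b'.val, ?_, ?_⟩
    · rcases ha' with rfl | rfl | rfl
      · simp
      · simp [ZMod.val_one]
      · rw [hyAval]; simp
    · rcases hb' with rfl | rfl | rfl
      · simp
      · simp [ZMod.val_one]
      · rw [hyBval]; simp
    · rw [ZMod.val_add, ZMod.val_mul]
      generalize w.val * b'.val = m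
      omega

/-- A translate by `−e` misses `60 = −1` when `e − 1 ∉ S`. [folklore] -/
theorem sixty_not_mem_image {S : Finset (ZMod 61)} {e : ZMod 61} (he1 : e - 1 ∉ S) : (60 : ZMod 61) ∉ S.image (· + -e) := by
  intro h
  obtain ⟨x, hx, hxe⟩ := mem_image.1 h
  have h61b : (60 : ZMod 61) = -1 := by
    have h := ZMod.natCast_self 61
    push_cast at h
    linear_combination h
  apply he1
  have hx' : x = e - 1 := by linear_combination hxe + h61b
  rw [← hx']; exact hx

end Summit.MatrixMultiplication.OmegaCensus.CubeNB.S2
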